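import Literature.NumberTheory.GaloisRepresentations.LubinTateColemanCoordCoinvariantDivisionTwo
import Literature.NumberTheory.GaloisRepresentations.PowerSeriesTopNilpotentEvalDivision
import Literature.RingTheory.PowerSeries.WeierstrassEvaluationAtMaximal
import HarnessLib

/-!
# De Shalit II §4.12 on the series side AT A GENERAL POINT OF `𝔪`: the divided element `L_ε` when the auxiliary index `a₁` has
# `t_{v a₁} − N a₁ = T − b` with `b` in the MAXIMAL ideal of the base (not only in `(π)`), and the RESCALING that brings a
# Frobenius-moving Galois cocycle `σ_{v c}(C g_c • x a) + n_a x c = σ_{v a}(C g_a • x c) + n_c x a` to that shape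

De Shalit, *Iwasawa theory of elliptic curves with complex multiplication* (1987), II §4.12 (29)–(33), III §1.4 (5).  The lane's
`existsUnique_colemanDeltaCoinvFun_eq_mul` (`LubinTateColemanCoordCoinvariantDivisionTwo`) divides the cocycle by `t_γ − C n₁ = T − C(n₁ − 1)`
using the `(π)`-adic evaluation `tEval`, so it needs `n₁ − 1 ∈ (π)`.  In the two-variable frame (`S = 𝒪_F⟦X⟧`) the indices are GLOBAL Artin
symbols `σ̃_𝔞`, which move the unramified tower `E_∞`; by `colemanImage_galAct` they act on the Coleman module as `σ_{χ(σ̃)} ∘ (C g_{σ̃} • ·)` with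
`g_{σ̃} ∈ 𝒪_F⟦X⟧^×` the Amice element of `σ̃|_{E_∞}`, and after rescaling the index `a₁` contributes `T − b` with `b = n₁ g_{a₁}⁻¹ − 1 ∈ (π, X) = 𝔪_S`,
which is in `(π)` only if `σ̃_{a₁}` fixes `E_∞` — impossible for a non-trivial ideal.  THIS file removes that restriction (everything PROVED,
0 sorry, no definitions, no named facts):

* §1 ★★★ `existsUnique_colemanDeltaCoinvFun_eq_mul_of_mem_maximalIdeal` — S11's `∃! L` with `n₁ − 1 ∈ 𝔪_S` and the auxiliary condition read
  through `Literature.RingTheory.PowerSeries.maxEval` (Weierstrass evaluation at a point of `𝔪`; `S` a complete local domain, e.g. `𝒪_F⟦X⟧`);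
  `maxEval_eq_tEval` (the new evaluation extends the old one on `(π)`);
* §2 ★ `unitTwistₗ_rescale_rel` — the relation `σ_{v c}(C g_c • x a) + C n_a • x c = σ_{v a}(C g_a • x c) + C n_c • x a` (`g_i ∈ S^×`) becomes the
  lane's cocycle shape `σ_{v c}(x' a) + N' a • x' c = σ_{v a}(x' c) + N' c • x' a` for `x' i := C g_i⁻¹ • x i`, `N' i := C(n_i g_i⁻¹)`;
  `colemanDeltaCoinvFun_rescale` (`φ_ε(x i) = C g_i · φ_ε(x' i)`);
* §3 ★★★ `existsUnique_colemanDeltaCoinvFun_eq_twistMul_of_rel` — from the `g`-twisted relation, `v a₁ = γ`, and ONE auxiliary index `a₂`: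
  **∃! `L ∈ S⟦T⟧` with `φ_ε(x c) = (t_{v c}·C g_c − C n_c)·L` for every `c`** — de Shalit's `μ(𝔣)_ε` for a family indexed by Galois elements
  with ARBITRARY action on the unramified direction; `colemanDeltaCoinvFun_map_span_range_eq_span_twistMul` (`φ_ε(Λ·span x) = span{(t_{v c} g_c − n_c)·L}`).

## References
* E. de Shalit, *Iwasawa theory of elliptic curves with complex multiplication* (1987), Ch. II §4.12 (29)–(33); Ch. III §1.3, §1.4 (5). [deShalit1987]
* L. C. Washington, *Introduction to Cyclotomic Fields*, 2nd ed. (1997), §7.1 Prop. 7.2. [Washington1997]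
-/

noncomputable section

open PowerSeries

namespace Literature.NumberTheory.GaloisRepresentations

open GaloisRepresentations.IsNonarchimedeanLocalField LubinTate ValuativeRel
open Literature.RingTheory.PowerSeries (maxEval maxEval_eq_of_eq)

/-! ### §0. The Weierstrass evaluation extends the `(p)`-adic one -/

section Compat

open LubinTate

variable {A : Type*} [CommRing A] [IsLocalRing A] {p : A} [IsAdicComplete (Ideal.span {p}) A]
  [IsAdicComplete (IsLocalRing.maximalIdeal A) A] (hp : p ∈ IsLocalRing.maximalIdeal A) {b : A} (hb : b ∈ Ideal.span {p})

/-- **`maxEval b f = tEval b f`** for `b ∈ (p) ⊆ 𝔪_A`: the Weierstrass evaluation at a point of `𝔪` extends the lane's `(p)`-adic evaluation.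
[cite: Washington1997, §7.1 Prop. 7.2] -/
theorem maxEval_eq_tEval (f : PowerSeries A) : maxEval (mem_maximalIdeal_of_mem_span hb hp) f = tEval hb f :=
  maxEval_eq_of_eq _ (eq_X_sub_C_mul_weierstrassDiv_add_C_tEval hb hp f)

end Compat

variable {F : Type} [Field F] [ValuativeRel F] [TopologicalSpace F] [IsNonarchimedeanLocalField F]

attribute [local instance] ltNormUniformSpace ltNormIsUniformAddGroup rk1 nF nE fintypeResidueField

variable {π : 𝒪[F]} (hπ : (valuation F).IsUniformizer (π : F)) (hq : residueFieldCard F = 2)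
variable {S : Type*} [CommRing S] (ι : LTCoeff F →+* S) [IsAdicComplete (Ideal.span {ι (LTCoeff.of F π)}) S]
variable (u : (LTCoeff F)ˣ) (hu : LTCoeff.of F π = residueFieldCard F * u) (γ : 𝒪[F]ˣ)
variable (hreg : ∀ x : S, ι (LTCoeff.of F π) * x = 0 → x = 0) (w : 𝒪[F]ˣ) (hγ : (γ : 𝒪[F]) = 1 + π ^ 2 * w)
variable (ε : PowerSeries S) (hε : ε * ε = 1)

/-! ### §1. Division at a general point of the maximal ideal -/

section Maximal

variable [IsLocalRing S] [IsAdicComplete (IsLocalRing.maximalIdeal S) S]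

include hε in
/-- ★★★ **DE SHALIT II §4.12 ON THE SERIES SIDE, GENERAL POINT OF `𝔪`**: let `x : I → M` satisfy the cocycle relation
`σ_{v c}(x a) + N a • x c = σ_{v a}(x c) + N c • x a`, let `a₁` have `v a₁ = γ` and `N a₁ = C n₁` with `n₁ − 1 ∈ 𝔪_S` (ANY point of the maximal
ideal of the complete local domain `S`), and let `a₂` have `(t_{v a₂} − N a₂)(n₁ − 1) ≠ 0` (Weierstrass value).  Then **there is a UNIQUE `L ∈ S⟦T⟧` with
`φ_ε(x c) = (t_{v c} − N c)·L` for every `c`**. [cite: deShalit1987, Ch. II §4.12 (29)–(33)] [cite: Washington1997, §7.1 Prop. 7.2] -/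
theorem existsUnique_colemanDeltaCoinvFun_eq_mul_of_mem_maximalIdeal [IsDomain S] {I : Type*} (x : I → ColemanCoordModule hπ hq ι u hu γ)
    (v : I → 𝒪[F]ˣ) (N : I → PowerSeries S)
    (hrel : ∀ a c : I, unitTwistₗ hπ hq ι u hu γ (v c) (x a) + N a • x c =
      unitTwistₗ hπ hq ι u hu γ (v a) (x c) + N c • x a)
    (a₁ a₂ : I) (hv₁ : v a₁ = γ) {n₁ : S} (hN₁ : N a₁ = PowerSeries.C n₁)
    (hn₁ : n₁ - 1 ∈ IsLocalRing.maximalIdeal S)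
    (ha₂ : maxEval hn₁ (colemanDeltaCoinvFun hπ hq ι u hu γ hreg w hγ ε
        (unitTwistₗ hπ hq ι u hu γ (v a₂) (TActModule.ofPS _ _ 1)) - N a₂) ≠ 0) :
    ∃! L : PowerSeries S, ∀ c : I,
      colemanDeltaCoinvFun hπ hq ι u hu γ hreg w hγ ε (x c) =
        (colemanDeltaCoinvFun hπ hq ι u hu γ hreg w hγ ε
          (unitTwistₗ hπ hq ι u hu γ (v c) (TActModule.ofPS _ _ 1)) - N c) * L := by
  -- the denominator at `a₁` is `1 · (T − C(n₁ − 1))`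
  have hd₁ : colemanDeltaCoinvFun hπ hq ι u hu γ hreg w hγ ε
        (unitTwistₗ hπ hq ι u hu γ (v a₁) (TActModule.ofPS _ _ 1)) - N a₁ =
      1 * (PowerSeries.X - PowerSeries.C (n₁ - 1)) := by
    rw [hv₁, hN₁]; exact colemanDeltaCoinvFun_unitTwistₗ_self_one_sub_C hπ hq ι u hu γ hreg w hγ ε n₁
  have hreg₁ := Literature.RingTheory.PowerSeries.mem_nonZeroDivisors_of_eq_unit_mul_X_sub_C hn₁ isUnit_one hd₁
  have hcoc := colemanDeltaCoinvFun_cocycle hπ hq ι u hu γ hreg w hγ ε hε x v N hrel a₁ a₂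
  obtain ⟨L, hL⟩ := Literature.RingTheory.PowerSeries.exists_eq_mul_of_mul_eq_mul hn₁ isUnit_one hd₁ hcoc ha₂
  refine ⟨L, fun c => colemanDeltaCoinvFun_eq_mul_of_divides hπ hq ι u hu γ hreg w hγ ε hε x v N hrel a₁ L hreg₁ hL c, fun L' hL' => ?_⟩
  exact (mul_cancel_left_mem_nonZeroDivisors hreg₁).mp ((hL' a₁).symm.trans hL)

end Maximal

/-! ### §2. Rescaling a `g`-twisted relation to the cocycle shape -/

section Rescale

variable {I : Type*} (x : I → ColemanCoordModule hπ hq ι u hu γ) (v : I → 𝒪[F]ˣ) (g : I → Sˣ) (n : I → S)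

/-- ★ **Rescaling**: if `σ_{v c}(C g_c • x a) + C n_a • x c = σ_{v a}(C g_a • x c) + C n_c • x a` for all `a, c` (`g_i` units of `S` — the Amice
elements of Frobenius-moving Galois indices), then `x' i := C g_i⁻¹ • x i`, `N' i := C(n_i g_i⁻¹)` satisfy the lane's cocycle shape
`σ_{v c}(x' a) + N' a • x' c = σ_{v a}(x' c) + N' c • x' a`. [cite: deShalit1987, Ch. II §4.12 (29); Ch. I §3.4 Lemma (ii)] -/
theorem unitTwistₗ_rescale_rel
    (hrel : ∀ a c : I, unitTwistₗ hπ hq ι u hu γ (v c) ((PowerSeries.C (g c : S) : PowerSeries S) • x a) +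
        (PowerSeries.C (n a) : PowerSeries S) • x c =
      unitTwistₗ hπ hq ι u hu γ (v a) ((PowerSeries.C (g a : S) : PowerSeries S) • x c) + (PowerSeries.C (n c) : PowerSeries S) • x a)
    (a c : I) :
    unitTwistₗ hπ hq ι u hu γ (v c) ((PowerSeries.C ((g a)⁻¹ : Sˣ) : PowerSeries S) • x a) +
        (PowerSeries.C (n a * ((g a)⁻¹ : Sˣ)) : PowerSeries S) • ((PowerSeries.C ((g c)⁻¹ : Sˣ) : PowerSeries S) • x c) =
      unitTwistₗ hπ hq ι u hu γ (v a) ((PowerSeries.C ((g c)⁻¹ : Sˣ) : PowerSeries S) • x c) +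
        (PowerSeries.C (n c * ((g c)⁻¹ : Sˣ)) : PowerSeries S) • ((PowerSeries.C ((g a)⁻¹ : Sˣ) : PowerSeries S) • x a) := by
  have h := congrArg (fun m => (PowerSeries.C (((g a)⁻¹ : Sˣ) * ((g c)⁻¹ : Sˣ) : S) : PowerSeries S) • m) (hrel a c)
  simp only [smul_add, ← map_smul, smul_smul, ← map_mul] at h
  have e1 : (((g a)⁻¹ : Sˣ) * ((g c)⁻¹ : Sˣ) : S) * (g c : S) = ((g a)⁻¹ : Sˣ) := by
    rw [mul_assoc, Units.inv_mul, mul_one]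
  have e2 : (((g a)⁻¹ : Sˣ) * ((g c)⁻¹ : Sˣ) : S) * (g a : S) = ((g c)⁻¹ : Sˣ) := by
    rw [mul_comm (((g a)⁻¹ : Sˣ) : S), mul_assoc, Units.inv_mul, mul_one]
  have e3 : (((g a)⁻¹ : Sˣ) * ((g c)⁻¹ : Sˣ) : S) * n a = n a * ((g a)⁻¹ : Sˣ) * ((g c)⁻¹ : Sˣ) := by ring
  have e4 : (((g a)⁻¹ : Sˣ) * ((g c)⁻¹ : Sˣ) : S) * n c = n c * ((g c)⁻¹ : Sˣ) * ((g a)⁻¹ : Sˣ) := by ring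
  rw [e1, e2, e3, e4, map_mul _ (n a * _), map_mul _ (n c * _), ← smul_smul, ← smul_smul] at h
  exact h

/-- **Unscaling on `φ_ε`**: `φ_ε(x i) = C g_i · φ_ε(C g_i⁻¹ • x i)`. [cite: deShalit1987, Ch. III §1.3] -/
theorem colemanDeltaCoinvFun_rescale (i : I) :
    colemanDeltaCoinvFun hπ hq ι u hu γ hreg w hγ ε (x i) =
      (PowerSeries.C (g i : S) : PowerSeries S) *
        colemanDeltaCoinvFun hπ hq ι u hu γ hreg w hγ ε ((PowerSeries.C ((g i)⁻¹ : Sˣ) : PowerSeries S) • x i) := by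
  rw [map_smul, smul_eq_mul, ← mul_assoc, ← map_mul, Units.mul_inv, map_one, one_mul]

/-- The twist scalar of the rescaled problem: `(t_v − C(n g⁻¹))·C g = t_v·C g − C n`. [cite: deShalit1987, Ch. II §4.12 (29)] -/
theorem sub_C_mul_inv_mul_C (t : PowerSeries S) (i : I) :
    (t - PowerSeries.C (n i * ((g i)⁻¹ : Sˣ))) * PowerSeries.C (g i : S) = t * PowerSeries.C (g i : S) - PowerSeries.C (n i) := by
  rw [sub_mul, ← map_mul, mul_assoc, Units.inv_mul, mul_one]

end Rescale

/-! ### §3. The divided element for a Frobenius-moving family -/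

section TwistDivision

variable [IsLocalRing S] [IsAdicComplete (IsLocalRing.maximalIdeal S) S] [IsDomain S]
variable {I : Type*} (x : I → ColemanCoordModule hπ hq ι u hu γ) (v : I → 𝒪[F]ˣ) (g : I → Sˣ) (n : I → S)

include hε in
/-- ★★★ **THE DIVIDED ELEMENT FOR A FROBENIUS-MOVING FAMILY**: if `σ_{v c}(C g_c • x a) + C n_a • x c = σ_{v a}(C g_a • x c) + C n_c • x a` for all
`a, c` (the module cocycle produced by `Col(σ̃·β) = σ_{χ(σ̃)}(C g_{σ̃} • Col β)` from the levelwise unit relation II §2.4 (ii)), if `v a₁ = γ` and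
`n_{a₁} g_{a₁}⁻¹ − 1 ∈ 𝔪_S` (automatic over `S = 𝒪_F⟦X⟧`: `g_{a₁}(0) = 1`, `n_{a₁}` odd), and if ONE index `a₂` has non-zero Weierstrass value
`(t_{v a₂} − C(n_{a₂} g_{a₂}⁻¹))(n_{a₁} g_{a₁}⁻¹ − 1) ≠ 0`, then **there is a UNIQUE `L ∈ S⟦T⟧` with `φ_ε(x c) = (t_{v c}·C g_c − C n_c)·L` for every `c`**.
[cite: deShalit1987, Ch. II §4.12 (29)–(33); Ch. I §3.4 Lemma (ii)] [cite: Washington1997, §7.1 Prop. 7.2] -/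
theorem existsUnique_colemanDeltaCoinvFun_eq_twistMul_of_rel
    (hrel : ∀ a c : I, unitTwistₗ hπ hq ι u hu γ (v c) ((PowerSeries.C (g c : S) : PowerSeries S) • x a) +
        (PowerSeries.C (n a) : PowerSeries S) • x c =
      unitTwistₗ hπ hq ι u hu γ (v a) ((PowerSeries.C (g a : S) : PowerSeries S) • x c) + (PowerSeries.C (n c) : PowerSeries S) • x a)
    (a₁ a₂ : I) (hv₁ : v a₁ = γ) (hn₁ : n a₁ * ((g a₁)⁻¹ : Sˣ) - 1 ∈ IsLocalRing.maximalIdeal S)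
    (ha₂ : maxEval hn₁ (colemanDeltaCoinvFun hπ hq ι u hu γ hreg w hγ ε
        (unitTwistₗ hπ hq ι u hu γ (v a₂) (TActModule.ofPS _ _ 1)) - PowerSeries.C (n a₂ * ((g a₂)⁻¹ : Sˣ))) ≠ 0) :
    ∃! L : PowerSeries S, ∀ c : I,
      colemanDeltaCoinvFun hπ hq ι u hu γ hreg w hγ ε (x c) =
        (colemanDeltaCoinvFun hπ hq ι u hu γ hreg w hγ ε (unitTwistₗ hπ hq ι u hu γ (v c) (TActModule.ofPS _ _ 1)) *
            PowerSeries.C (g c : S) - PowerSeries.C (n c)) * L := by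
  have hex := existsUnique_colemanDeltaCoinvFun_eq_mul_of_mem_maximalIdeal hπ hq ι u hu γ hreg w hγ ε hε
    (fun i => (PowerSeries.C ((g i)⁻¹ : Sˣ) : PowerSeries S) • x i) v (fun i => PowerSeries.C (n i * ((g i)⁻¹ : Sˣ)))
    (unitTwistₗ_rescale_rel hπ hq ι u hu γ x v g n hrel) a₁ a₂ hv₁ rfl hn₁ ha₂
  -- translate `φ_ε(x' c) = (t − N' c)·L` into `φ_ε(x c) = (t·C g_c − C n_c)·L`
  have key : ∀ L : PowerSeries S, (∀ c : I,
      colemanDeltaCoinvFun hπ hq ι u hu γ hreg w hγ ε ((PowerSeries.C ((g c)⁻¹ : Sˣ) : PowerSeries S) • x c) =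
        (colemanDeltaCoinvFun hπ hq ι u hu γ hreg w hγ ε (unitTwistₗ hπ hq ι u hu γ (v c) (TActModule.ofPS _ _ 1)) -
          PowerSeries.C (n c * ((g c)⁻¹ : Sˣ))) * L) ↔
      (∀ c : I, colemanDeltaCoinvFun hπ hq ι u hu γ hreg w hγ ε (x c) =
        (colemanDeltaCoinvFun hπ hq ι u hu γ hreg w hγ ε (unitTwistₗ hπ hq ι u hu γ (v c) (TActModule.ofPS _ _ 1)) *
            PowerSeries.C (g c : S) - PowerSeries.C (n c)) * L) := by
    intro L
    refine forall_congr' fun c => ?_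
    rw [colemanDeltaCoinvFun_rescale hπ hq ι u hu γ hreg w hγ ε x g c, ← sub_C_mul_inv_mul_C g n _ c]
    constructor
    · intro h; rw [h]; ring
    · intro h
      have hu : IsUnit (PowerSeries.C (g c : S) : PowerSeries S) := (Units.isUnit (g c)).map PowerSeries.C
      refine hu.mul_left_cancel ?_
      rw [h]; ring
  obtain ⟨L, hL, huniq⟩ := hex
  exact ⟨L, (key L).mp hL, fun L' hL' => huniq L' ((key L').mpr hL')⟩

omit [IsLocalRing S] [IsAdicComplete (IsLocalRing.maximalIdeal S) S] [IsDomain S] in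
/-- ★ **`φ_ε(Λ·span{x c}) = span{(t_{v c}·C g_c − C n_c)·L}`** (de Shalit III §1.4 (5) on the `ε`-part, Frobenius-moving indices) for the `L` of
`existsUnique_colemanDeltaCoinvFun_eq_twistMul_of_rel` (any `L` with the displayed property). [cite: deShalit1987, Ch. III §1.4 (5); Ch. II §4.12 (33)] -/
theorem colemanDeltaCoinvFun_map_span_range_eq_span_twistMul (L : PowerSeries S)
    (hL : ∀ c : I, colemanDeltaCoinvFun hπ hq ι u hu γ hreg w hγ ε (x c) =
      (colemanDeltaCoinvFun hπ hq ι u hu γ hreg w hγ ε (unitTwistₗ hπ hq ι u hu γ (v c) (TActModule.ofPS _ _ 1)) *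
          PowerSeries.C (g c : S) - PowerSeries.C (n c)) * L) :
    (Submodule.span (PowerSeries S) (Set.range x)).map (colemanDeltaCoinvFun hπ hq ι u hu γ hreg w hγ ε) =
      Ideal.span (Set.range fun c =>
        (colemanDeltaCoinvFun hπ hq ι u hu γ hreg w hγ ε (unitTwistₗ hπ hq ι u hu γ (v c) (TActModule.ofPS _ _ 1)) *
            PowerSeries.C (g c : S) - PowerSeries.C (n c)) * L) := by
  have hfun : (⇑(colemanDeltaCoinvFun hπ hq ι u hu γ hreg w hγ ε) ∘ x) = fun c =>
      (colemanDeltaCoinvFun hπ hq ι u hu γ hreg w hγ ε (unitTwistₗ hπ hq ι u hu γ (v c) (TActModule.ofPS _ _ 1)) *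
          PowerSeries.C (g c : S) - PowerSeries.C (n c)) * L :=
    funext fun c => hL c
  rw [Submodule.map_span, ← Set.range_comp, hfun]

end TwistDivision

end Literature.NumberTheory.GaloisRepresentations
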